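import Summits.ValiantsHypothesis.ValiantsHypothesis.Theorems.GrenetZeonDualUnipotentThreeHalvesHeavyTopCodimOneCountLevels
import Summits.ValiantsHypothesis.ValiantsHypothesis.Theorems.GrenetZeonDualUnipotentThreeHalvesHeavyTopCodimOneArithLevels
import Summits.ValiantsHypothesis.ValiantsHypothesis.Theorems.GrenetZeonDualUnipotentThreeHalvesHeavyTopCodimOneBlocks

/-!
# `GrenetZeon.DualUnipotentThreeHalves` (stmt-ValiantsHypothesis-24318), R2 heavy-top instrument — COROLLARY II port, step (c1):
# DEFICIENCY ONE ⇒ the composition chain has block sizes in `{1, 3}` with AT MOST ONE `3`-block, which carries a PLANE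

Let `V ≤ M_m(ℂ)` be block upper-triangular for `lvl : Fin m → ℕ` (values `< L`, convention of ✓ `HeavyTopCompositionBlocks.exists_block_conj`),
with re-indexed diagonal blocks in spaces `W t ≤ M_{s t}(ℂ)` that are NILPOTENT and IRREDUCIBLE (as `exists_block_conj` delivers after conjugation),
and let `C(m,2) ≤ dim V + 1` (deficiency at most one).  Summing the block deficiencies (✓ graded count `finrank_le_of_levels`, ✓ position count
`choose_two_eq_sum_levels`, ✓ table `…HeavyTopCodimOneBlocks`):

* `not_irreducible_of_size_two`, `finrank_le_two_of_size_three` — size-generic wrappers of the table (`n = 2`, `n = 3`);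
* `sum_choose_two_le` — `Σ_t C(s_t,2) ≤ Σ_t dim (W t) + 1`;
* ★ `levels_of_deficiency_le_one` — every level has size `≤ 1` or `3`; two levels of size `3` coincide; a level of size `3` has `dim (W t) = 2`.

This is the combinatorial heart of COROLLARY II by the composition-chain route (crux note `CENSUS-THMC-UNIFORM-eng1g5.md` §8): what remains for the
classification file is the conjugation plumbing (`exists_block_conj`, block images as `Submodule.map`, coarsening to three levels around the
`3`-block, ✓ `mem_iff_of_three_levels`, Gerstenhaber-equality units on the two coarse blocks, re-indexing onto ✓ `towerHull`).

Honest framing: counting; nothing here proves or refutes `HeavyTopLaw`, 24318, S3b or 8062; `VP ≠ VNP` is NOT proved.  No definitions.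
[val-idea-30 MEMO codim-one §0 COROLLARY II, completeness count (critic val-idea-crit-7 g7 (iii)); cell val-heavytop-census, eng-1 g5]
-/

noncomputable section

-- single-conjunct layout: Sub = Summit, duplicated namespace component intended
set_option linter.dupNamespace false

namespace Summit.ValiantsHypothesis.ValiantsHypothesis.Theorems.GrenetZeon.HeavyTopCodimOneLevels

open Matrix
open Summit.ValiantsHypothesis.ValiantsHypothesis.Theorems.GrenetZeon.HeavyTopCodimOneCount (finrank_le_of_levels)
open Summit.ValiantsHypothesis.ValiantsHypothesis.Theorems.GrenetZeon.HeavyTopCodimOneArith (choose_two_eq_sum_levels)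
open Summit.ValiantsHypothesis.ValiantsHypothesis.Theorems.GrenetZeon.HeavyTopCodimOneBlocks (not_irreducible_of_nilpotent_two
  finrank_le_two_of_irreducible_three finrank_add_two_le_choose_two)

/-- Size-generic form of ✓ `not_irreducible_of_nilpotent_two`. -/
theorem not_irreducible_of_size_two {n : ℕ} (hn : n = 2) (W : Submodule ℂ (Matrix (Fin n) (Fin n) ℂ)) (hW : ∀ A ∈ W, IsNilpotent A) :
    ¬ ∀ U : Submodule ℂ (Fin n → ℂ), (∀ A ∈ W, ∀ x ∈ U, A *ᵥ x ∈ U) → U = ⊥ ∨ U = ⊤ := by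
  subst hn
  exact not_irreducible_of_nilpotent_two W hW

/-- Size-generic form of ✓ `finrank_le_two_of_irreducible_three`. -/
theorem finrank_le_two_of_size_three {n : ℕ} (hn : n = 3) (W : Submodule ℂ (Matrix (Fin n) (Fin n) ℂ)) (hW : ∀ A ∈ W, IsNilpotent A)
    (hirr : ∀ U : Submodule ℂ (Fin n → ℂ), (∀ A ∈ W, ∀ x ∈ U, A *ᵥ x ∈ U) → U = ⊥ ∨ U = ⊤) :
    Module.finrank ℂ W ≤ 2 := by
  subst hn
  exact finrank_le_two_of_irreducible_three W hW hirr

/-- **The deficiencies sum to at most one:** `Σ_t C(s_t,2) ≤ Σ_t dim (W t) + 1` when `C(m,2) ≤ dim V + 1`. -/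
theorem sum_choose_two_le {m L : ℕ} (lvl : Fin m → ℕ) (hlvl : ∀ i, lvl i < L) (s : Fin L → ℕ)
    (e : ∀ t : Fin L, {i : Fin m // lvl i = (t : ℕ)} ≃ Fin (s t))
    (V : Submodule ℂ (Matrix (Fin m) (Fin m) ℂ)) (hblock : ∀ A ∈ V, ∀ i j, lvl i < lvl j → A i j = 0)
    (W : ∀ t : Fin L, Submodule ℂ (Matrix (Fin (s t)) (Fin (s t)) ℂ))
    (hW : ∀ A ∈ V, ∀ t : Fin L,
      Matrix.reindex (e t) (e t) (A.toBlock (fun i => lvl i = (t : ℕ)) (fun i => lvl i = (t : ℕ))) ∈ W t)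
    (hdim : m.choose 2 ≤ Module.finrank ℂ V + 1) :
    ∑ t, (s t).choose 2 ≤ ∑ t, Module.finrank ℂ (W t) + 1 := by
  have hcount := finrank_le_of_levels lvl hlvl s e V hblock W hW
  have harith := choose_two_eq_sum_levels lvl hlvl
  rw [Finset.sum_range (fun t => (Fintype.card {i : Fin m // lvl i = t}).choose 2)] at harith
  have hs : ∀ t : Fin L, Fintype.card {i : Fin m // lvl i = (t : ℕ)} = s t := fun t => by
    rw [Fintype.card_congr (e t), Fintype.card_fin]
  simp only [hs] at harith
  omega

/-- ★ **Deficiency one forces block sizes in `{≤ 1, 3}`, at most one `3`-block, and a PLANE on it.**  Under the hypotheses of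
`sum_choose_two_le` with the `W t` nilpotent and irreducible: (i) every `s t ≤ 1` or `s t = 3`; (ii) `s t = 3 = s t'` forces `t = t'`;
(iii) `s t = 3` forces `dim (W t) = 2`. [val-idea-30 MEMO codim-one, COROLLARY II completeness count] -/
theorem levels_of_deficiency_le_one {m L : ℕ} (lvl : Fin m → ℕ) (hlvl : ∀ i, lvl i < L) (s : Fin L → ℕ)
    (e : ∀ t : Fin L, {i : Fin m // lvl i = (t : ℕ)} ≃ Fin (s t))
    (V : Submodule ℂ (Matrix (Fin m) (Fin m) ℂ)) (hblock : ∀ A ∈ V, ∀ i j, lvl i < lvl j → A i j = 0)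
    (W : ∀ t : Fin L, Submodule ℂ (Matrix (Fin (s t)) (Fin (s t)) ℂ))
    (hW : ∀ A ∈ V, ∀ t : Fin L,
      Matrix.reindex (e t) (e t) (A.toBlock (fun i => lvl i = (t : ℕ)) (fun i => lvl i = (t : ℕ))) ∈ W t)
    (hWnil : ∀ t : Fin L, ∀ X ∈ W t, IsNilpotent X)
    (hWirr : ∀ t : Fin L, ∀ U : Submodule ℂ (Fin (s t) → ℂ), (∀ X ∈ W t, ∀ x ∈ U, X *ᵥ x ∈ U) → U = ⊥ ∨ U = ⊤)
    (hdim : m.choose 2 ≤ Module.finrank ℂ V + 1) :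
    (∀ t, s t ≤ 1 ∨ s t = 3) ∧ (∀ t t', s t = 3 → s t' = 3 → t = t') ∧ (∀ t, s t = 3 → Module.finrank ℂ (W t) = 2) := by
  classical
  have hsum := sum_choose_two_le lvl hlvl s e V hblock W hW hdim
  have hG : ∀ t : Fin L, Module.finrank ℂ (W t) ≤ (s t).choose 2 := fun t =>
    Literature.LinearAlgebra.Matrix.GerstenhaberNilpotentSubspace.finrank_le_choose_two (s t) (W t) (hWnil t)
  -- isolating one level `t₀`: `C(s t₀, 2) + Σ_{t ≠ t₀} dim W t ≤ Σ_t dim W t + 1`... via the erase decomposition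
  have hiso : ∀ t₀ : Fin L, (s t₀).choose 2 + ∑ t ∈ Finset.univ.erase t₀, Module.finrank ℂ (W t) ≤
      Module.finrank ℂ (W t₀) + ∑ t ∈ Finset.univ.erase t₀, Module.finrank ℂ (W t) + 1 := by
    intro t₀
    have h1 : ∑ t, (s t).choose 2 = (s t₀).choose 2 + ∑ t ∈ Finset.univ.erase t₀, (s t).choose 2 :=
      (Finset.add_sum_erase _ _ (Finset.mem_univ t₀)).symm
    have h2 : ∑ t, Module.finrank ℂ (W t) = Module.finrank ℂ (W t₀) + ∑ t ∈ Finset.univ.erase t₀, Module.finrank ℂ (W t) :=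
      (Finset.add_sum_erase _ _ (Finset.mem_univ t₀)).symm
    have h3 : ∑ t ∈ Finset.univ.erase t₀, Module.finrank ℂ (W t) ≤ ∑ t ∈ Finset.univ.erase t₀, (s t).choose 2 :=
      Finset.sum_le_sum fun t _ => hG t
    omega
  -- hence every single deficiency is `≤ 1`
  have hdef : ∀ t : Fin L, (s t).choose 2 ≤ Module.finrank ℂ (W t) + 1 := fun t => by have := hiso t; omega
  -- (i) sizes
  have hsize : ∀ t, s t ≤ 1 ∨ s t = 3 := by
    intro t
    rcases Nat.lt_or_ge (s t) 4 with hlt | hge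
    · by_cases h2 : s t = 2
      · exact absurd (hWirr t) (not_irreducible_of_size_two h2 (W t) (hWnil t))
      · omega
    · exfalso
      have := finrank_add_two_le_choose_two hge (W t) (hWnil t) (hWirr t)
      have := hdef t
      omega
  -- (iii) a `3`-block carries a plane
  have hplane : ∀ t, s t = 3 → Module.finrank ℂ (W t) = 2 := by
    intro t ht
    have hle := finrank_le_two_of_size_three ht (W t) (hWnil t) (hWirr t)
    have := hdef t
    have h3 : (s t).choose 2 = 3 := by rw [ht]; rfl
    omega
  refine ⟨hsize, fun t t' ht ht' => ?_, hplane⟩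
  -- (ii) two `3`-blocks cost two
  by_contra hne
  have hmem : t' ∈ (Finset.univ : Finset (Fin L)).erase t := Finset.mem_erase.2 ⟨Ne.symm hne, Finset.mem_univ t'⟩
  have h1 : ∑ u, (s u).choose 2 = (s t).choose 2 + ((s t').choose 2 + ∑ u ∈ (Finset.univ.erase t).erase t', (s u).choose 2) := by
    rw [Finset.add_sum_erase ((Finset.univ : Finset (Fin L)).erase t) (fun u => (s u).choose 2) hmem]
    exact (Finset.add_sum_erase _ _ (Finset.mem_univ t)).symm
  have h2 : ∑ u, Module.finrank ℂ (W u) = Module.finrank ℂ (W t) + (Module.finrank ℂ (W t') +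
      ∑ u ∈ (Finset.univ.erase t).erase t', Module.finrank ℂ (W u)) := by
    rw [Finset.add_sum_erase ((Finset.univ : Finset (Fin L)).erase t) (fun u => Module.finrank ℂ (W u)) hmem]
    exact (Finset.add_sum_erase _ _ (Finset.mem_univ t)).symm
  have h3 : ∑ u ∈ (Finset.univ.erase t).erase t', Module.finrank ℂ (W u) ≤ ∑ u ∈ (Finset.univ.erase t).erase t', (s u).choose 2 :=
    Finset.sum_le_sum fun u _ => hG u
  have h4 := hplane t ht
  have h5 := hplane t' ht'
  have h6 : (s t).choose 2 = 3 := by rw [ht]; rfl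
  have h7 : (s t').choose 2 = 3 := by rw [ht']; rfl
  omega

end Summit.ValiantsHypothesis.ValiantsHypothesis.Theorems.GrenetZeon.HeavyTopCodimOneLevels

end
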